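import Summits.AtomisticToContinuum.FouriersLaw.Theorems.JunctionLocalityDefs

/-!
# The light-cone window from fixed-time locality: the diagonal extraction

Helper (`--supports`) for the line `contact-current-forgetting` of the crux `JunctionLocality.NonBallistic`
(stmt-AtomisticToContinuum-9127), stub `stub_lightConeWindow` (LC).

The registered stub asks for a window `t₀(N) → ∞` and levels `η_N` with `η_N t₀(N) → 0` such that the extreme
Green–Kubo entry `M_N(0,N-2)(t) = gkEntry P N T 0 (N-2) t` (route Defs file `JunctionLocalityDefs.lean`) is bounded
by `η_N` on `0 ≤ t ≤ t₀(N)`, for every `N ≥ 2`. This file isolates its whole DYNAMICAL content as the fixed-time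
locality statement

  `(FTL)  ∀ t⋆, ∀ ε > 0, ∃ N₀, ∀ N ≥ N₀, ∀ t ∈ [0, t⋆], |M_N(0,N-2)(t)| ≤ ε`

("at thermal equilibrium the far contact current has not heard of the near one by any fixed time, as the chain
grows": almost-finite propagation speed of the open anharmonic chain with its two Langevin baths, qualitative
form; Buttà–Caglioti–Di Ruzza–Marchioro, J. Stat. Phys. 127 (2007) 313; Buttà–Marchioro, J. Stat. Phys. 164
(2016) 680, Thm 2.2 for the infinite deterministic chain, in tree as `ButtaMarchioro2016_thm22_chain_holds`),
and proves the stub FROM it by a diagonal extraction of sequences (`exists_window_of_fixedTime`, pure real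
analysis: thresholds `N_k` for `(t⋆, ε) = (k, (k+1)⁻²)`, made monotone; level `K(N) = max{k : N_k ≤ N}`;
`t₀ = K`, `η = (K+1)⁻²`, and `t₀ = 0`, `η = |M_N(0)|` below the first threshold). (FTL) is equivalent to the
stub (the converse is immediate), so nothing is lost; (FTL) is in turn reduced to an `L²(μ_T)` flow-sensitivity
statement by the pairing bound of the companion file `…StubLightConeWindowAux1.lean`.
-/

noncomputable section

open MeasureTheory Set Filter Topology

namespace Summit.AtomisticToContinuum.FouriersLaw.Theorems.NonBallistic

open Literature.MathematicalPhysics.KineticTheory.HeatConduction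
open Summit.AtomisticToContinuum.FouriersLaw.Theorems.JunctionLocality

/-- **Diagonal extraction.** If a family `g N : ℝ → ℝ` is uniformly small on every bounded time window for
large `N` (`∀ t⋆ ε, 0 < ε → ∃ N₀, ∀ N ≥ N₀, ∀ t ∈ [0,t⋆], |g N t| ≤ ε`), then there are a window `t₀(N) → ∞`
(`t₀ ≥ 0`) and levels `η_N` with `η_N t₀(N) → 0` and `|g N t| ≤ η_N` for all `N` and `0 ≤ t ≤ t₀(N)`. [folklore] -/
theorem exists_window_of_fixedTime {g : ℕ → ℝ → ℝ}
    (hloc : ∀ tstar ε : ℝ, 0 < ε → ∃ N₀ : ℕ, ∀ N : ℕ, N₀ ≤ N → ∀ t : ℝ, 0 ≤ t → t ≤ tstar → |g N t| ≤ ε) :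
    ∃ t₀ η : ℕ → ℝ, (∀ N, 0 ≤ t₀ N) ∧ Tendsto t₀ atTop atTop ∧
      Tendsto (fun N => η N * t₀ N) atTop (𝓝 0) ∧
      ∀ N : ℕ, ∀ t : ℝ, 0 ≤ t → t ≤ t₀ N → |g N t| ≤ η N := by
  classical
  -- thresholds `N₀ k` for the window `[0, k]` and the level `1/(k+1)²`
  choose N₀ hN₀ using fun k : ℕ => hloc (k : ℝ) (1 / ((k : ℝ) + 1) ^ 2) (by positivity)
  -- monotone thresholds `B k ≥ N₀ k`, `B k ≥ k`
  set B : ℕ → ℕ := fun k => (Finset.range (k + 1)).sup N₀ + k with hB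
  have hBmono : Monotone B := by
    intro k l hkl
    exact Nat.add_le_add (Finset.sup_mono (Finset.range_mono (by omega : k + 1 ≤ l + 1))) hkl
  have hBN₀ : ∀ k, N₀ k ≤ B k := fun k =>
    (Finset.le_sup (f := N₀) (Finset.self_mem_range_succ k)).trans (Nat.le_add_right _ _)
  have hBk : ∀ k, k ≤ B k := fun k => Nat.le_add_left k _
  -- the level `K N = max {k ≤ N : B k ≤ N}`
  set K : ℕ → ℕ := fun N => Nat.findGreatest (fun k => B k ≤ N) N with hK
  have hKspec : ∀ N, B 0 ≤ N → B (K N) ≤ N := fun N h =>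
    Nat.findGreatest_spec (P := fun k => B k ≤ N) (Nat.zero_le N) h
  have hKge : ∀ k N, B k ≤ N → k ≤ K N := fun k N h =>
    Nat.le_findGreatest (P := fun k => B k ≤ N) ((hBk k).trans h) h
  refine ⟨fun N => if B 0 ≤ N then (K N : ℝ) else 0,
    fun N => if B 0 ≤ N then 1 / ((K N : ℝ) + 1) ^ 2 else |g N 0|, ?_, ?_, ?_, ?_⟩
  · intro N
    simp only
    split_ifs <;> positivity
  · refine tendsto_atTop_atTop.2 fun b => ⟨B ⌈b⌉₊, fun N hN => ?_⟩
    have h0 : B 0 ≤ N := (hBmono (Nat.zero_le _)).trans hN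
    simp only [if_pos h0]
    have h1 : (⌈b⌉₊ : ℝ) ≤ K N := by exact_mod_cast hKge _ N hN
    exact (Nat.le_ceil b).trans h1
  · rw [Metric.tendsto_atTop]
    intro ε hε
    obtain ⟨k, hk⟩ := exists_nat_one_div_lt hε
    refine ⟨B k, fun N hN => ?_⟩
    have h0 : B 0 ≤ N := (hBmono (Nat.zero_le _)).trans hN
    simp only [if_pos h0, Real.dist_eq, sub_zero]
    have hKk : (k : ℝ) ≤ K N := by exact_mod_cast hKge k N hN
    have hK0 : (0 : ℝ) ≤ K N := Nat.cast_nonneg _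
    rw [abs_of_nonneg (by positivity)]
    calc 1 / ((K N : ℝ) + 1) ^ 2 * K N ≤ 1 / ((K N : ℝ) + 1) := by
          rw [div_mul_eq_mul_div, one_mul, div_le_div_iff₀ (by positivity) (by positivity)]
          nlinarith
      _ ≤ 1 / ((k : ℝ) + 1) := one_div_le_one_div_of_le (by positivity) (by linarith)
      _ < ε := hk
  · intro N t ht0 ht1
    by_cases h0 : B 0 ≤ N
    · simp only [if_pos h0] at ht1 ⊢
      exact hN₀ (K N) N ((hBN₀ _).trans (hKspec N h0)) t ht0 ht1
    · simp only [if_neg h0] at ht1 ⊢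
      have : t = 0 := le_antisymm ht1 ht0
      subst this
      exact le_rfl

/-- **The light-cone window from fixed-time locality** (the registered stub `stub_lightConeWindow` of the line
`contact-current-forgetting`, VERBATIM, as the conclusion): if for every bounded time window the extreme
Green–Kubo entry `M_N(0,N-2)(t) = ⟨j₀, κ_t j_{N-2}⟩_{μ_T}` tends to `0` uniformly as `N → ∞` (fixed-time locality
of the equilibrium dynamics of the open chain — the one dynamical input, NOT proved here), then there is a window
`t₀(N) → ∞` with levels `η_N`, `η_N t₀(N) → 0`, bounding `|M_N(0,N-2)|` on `[0, t₀(N)]` for every `N ≥ 2`.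
[folklore] -/
theorem lightConeWindow_of_fixedTimeLocality :
    (∀ ω₂ lam β γ : ℝ, 0 < ω₂ → 0 < lam → 0 < β → 0 < γ → ∀ T : ℝ, 0 < T → ∀ tstar ε : ℝ, 0 < ε →
      ∃ N₀ : ℕ, ∀ N : ℕ, N₀ ≤ N → ∀ t : ℝ, 0 ≤ t → t ≤ tstar →
        |gkEntry (pinnedChain ω₂ lam β γ) N T 0 (N - 2) t| ≤ ε) →
    ∀ ω₂ lam β γ : ℝ, 0 < ω₂ → 0 < lam → 0 < β → 0 < γ → ∀ T : ℝ, 0 < T →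
      ∃ t₀ η : ℕ → ℝ, (∀ N, 0 ≤ t₀ N) ∧ Tendsto t₀ atTop atTop ∧
        Tendsto (fun N => η N * t₀ N) atTop (𝓝 0) ∧
        ∀ N : ℕ, 2 ≤ N → ∀ t : ℝ, 0 ≤ t → t ≤ t₀ N →
          |gkEntry (pinnedChain ω₂ lam β γ) N T 0 (N - 2) t| ≤ η N := by
  intro hloc ω₂ lam β γ hω hl hβ hγ T hT
  obtain ⟨t₀, η, h1, h2, h3, h4⟩ :=
    exists_window_of_fixedTime (g := fun N t => gkEntry (pinnedChain ω₂ lam β γ) N T 0 (N - 2) t)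
      (hloc ω₂ lam β γ hω hl hβ hγ T hT)
  exact ⟨t₀, η, h1, h2, h3, fun N _ t ht0 ht1 => h4 N t ht0 ht1⟩

end Summit.AtomisticToContinuum.FouriersLaw.Theorems.NonBallistic

end
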